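import Summits.BirchSwinnertonDyer.BirchSwinnertonDyer.Theorems.Rank2Observatory2DescZ2Kernel
import Summits.BirchSwinnertonDyer.BirchSwinnertonDyer.Theorems.Rank2Observatory2DescZ2Count
import Summits.BirchSwinnertonDyer.BirchSwinnertonDyer.Theorems.Rank2Observatory2DescVCover
import Literature.NumberTheory.EllipticCurves.MordellWeilTheoremProofs
import HarnessLib

/-!
# BirchSwinnertonDyer — rank ≥ 2 observatory: the rank bound of the quadratic-field 2-descent (`E(F)[2] = ℤ/2`)

HONEST FRAMING: per-curve certified theorems and census instruments; no claim on BSD in rank ≥ 2.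

Assembly (G4, field-agnostic half) of the successor instrument KERNEL-2DESC-Z2: for
`E_{a,b} : y² = x³ + a x² + b x` over a number field `F` with `X² + aX + b` irreducible, root
`θ ∈ K ⊇ F(θ)`, the tree's descent map `μ_θ(P) = (x(P) − θ)·K×²` (`…2DescMuMap.muHom`, `e = θ`)
is a homomorphism with kernel `2E(F)` (`…2DescZ2Kernel.exists_eq_two_nsmul_of_sub_theta_eq_sq`),
and `μ_θ(T) ≠ 1` for the rational `2`-torsion point `T = (0, 0)` as soon as `b = N_{K/F}(−θ)` is
not a square in `F`; so if every `μ_θ(P)` lies in a finite set `S ∋ 1` of square classes with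
`#S ≤ 2^(s+1)`, then `rank E(F) ≤ s` (Mordell–Weil finiteness `module_finite_point_holds` + the
`+1` counting lemma `…2DescZ2Count.finrank_le_of_range_subset`).

* `isSquare_of_neg_theta_eq_sq` — `−θ = (qθ + p)²` forces `b = (p² − apq + bq²)²`;
* `mordellWeilRank_le_of_sqClass_cover_z2` — the rank bound.

The per-curve work left to a row file is exactly as in the cubic-field instrument: a finite cover
`S` of the classes `(x − θ)·K×²` (units, primes dividing `q′(θ)·θ`, local kills) with
`#S ≤ 2^(s+1)`. Sorry-free; axioms `propext`, `Classical.choice`, `Quot.sound`.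
[cite: Cassels1991LecturesEllipticCurves, §15 Lemma 1, Lemma 2] [cite: SilvermanAEC2009, Prop. X.1.4]
-/

-- single-conjunct summit: `Summit.BirchSwinnertonDyer.BirchSwinnertonDyer.…` repeats the name by design
set_option linter.dupNamespace false

noncomputable section

open scoped Classical

open Literature.NumberTheory.EllipticCurves
open WeierstrassCurve WeierstrassCurve.Affine WeierstrassCurve.Affine.Point
open Summit.BirchSwinnertonDyer.BirchSwinnertonDyer.Rank2Observatory.TwoDescCubic

namespace Summit.BirchSwinnertonDyer.BirchSwinnertonDyer.Rank2Observatory.TwoDescZ2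

section RankBound

variable {F K : Type*} [Field F] [Field K] {φ : F →+* K} {θ : K} {a b : F}

/-- If `−θ = (qθ + p)²` in `K` (`θ² + aθ + b = 0`, `1, θ` independent over `F`) then `b` is a
square in `F` (`b = N(qθ + p)²`). [folklore] -/
theorem isSquare_of_neg_theta_eq_sq (hq : θ ^ 2 + φ a * θ + φ b = 0)
    (hlinK : ∀ c₀ c₁ : F, φ c₁ * θ + φ c₀ = 0 → c₀ = 0 ∧ c₁ = 0) {p q : F}
    (hsq : (0 : K) - θ = (φ q * θ + φ p) ^ 2) : IsSquare b := by
  have hco := hlinK (p ^ 2 - b * q ^ 2) (2 * p * q - a * q ^ 2 + 1) (by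
    simp only [map_sub, map_add, map_mul, map_pow, map_ofNat, map_one]
    linear_combination -hsq - (φ q) ^ 2 * hq)
  obtain ⟨hx, hr⟩ := hco
  refine ⟨p ^ 2 - a * p * q + b * q ^ 2, ?_⟩
  linear_combination (a * p ^ 2 - 2 * b * p * q + b) * hr - (p ^ 2 - b * q ^ 2 + a) * hx

variable [NumberField F] [CharZero K]

/-- **Rank bound of the quadratic-field descent (`E(F)[2] ⊇ ℤ/2`).** `W = E_{a,b}` over a number
field `F` (`a₁ = a₃ = a₆ = 0`, `a₂ = a`, `a₄ = b`), `θ ∈ K` with `θ² + aθ + b = 0` and `1, θ` an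
`F`-basis of `K`, `b` not a square in `F`. If the classes `(φ x − θ)·K×²` of all affine `F`-points lie
in a finite set `S ∋ 1` with `#S ≤ 2^(s+1)`, then `rank E(F) ≤ s`.
[cite: Cassels1991LecturesEllipticCurves, §15] -/
theorem mordellWeilRank_le_of_sqClass_cover_z2 (W : WeierstrassCurve F) [W.IsElliptic] (φ : F →+* K)
    (ha₁ : W.a₁ = 0) (ha₃ : W.a₃ = 0) (ha₂ : W.a₂ = a) (ha₄ : W.a₄ = b) (ha₆ : W.a₆ = 0)
    (hq : θ ^ 2 + φ a * θ + φ b = 0)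
    (hlinK : ∀ c₀ c₁ : F, φ c₁ * θ + φ c₀ = 0 → c₀ = 0 ∧ c₁ = 0)
    (hspanK : ∀ z : K, ∃ c₀ c₁ : F, z = φ c₁ * θ + φ c₀) (hb : ¬ IsSquare b)
    (S : Finset (SqUnits K)) (h1 : (1 : SqUnits K) ∈ S)
    (hS : ∀ x y : F, W.toAffine.Nonsingular x y → sqClass (φ x - θ) ∈ S)
    {s : ℕ} (hcard : S.card < 2 ^ (s + 2)) : W.mordellWeilRank ≤ s := by
  haveI : Module.Finite ℤ W.toAffine.Point := W.module_finite_point_holds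
  have hne := ne_of_linIndep₂ hlinK
  -- `θ` is a root of the cubic `X³ + aX² + bX` and of the `2`-division cubic
  have hroot : θ ^ 3 + φ W.a₂ * θ ^ 2 + φ W.a₄ * θ + φ W.a₆ = 0 := by
    rw [ha₂, ha₄, ha₆, _root_.map_zero]
    linear_combination θ * hq
  set ψ := muHom W.toAffine φ θ (two_division_cubic_of_a ha₁ ha₃ hroot) hne with hψ
  -- kernel: `μ_θ(P) = 1 ⇒ P ∈ 2E(F)`
  have hker : ∀ P : W.toAffine.Point, ψ P = 0 → ∃ Q : W.toAffine.Point, P = 2 • Q := by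
    intro P hP
    rw [hψ, muHom_apply, ofMul_eq_zero] at hP
    rcases P with _ | @⟨x, y, h⟩
    · exact ⟨0, (smul_zero 2).symm⟩
    · rw [muMap_some] at hP
      obtain ⟨u, hu⟩ := (sqClass_eq_one_iff (sub_ne_zero.mpr (hne x))).mp hP
      obtain ⟨c₀, c₁, rfl⟩ := hspanK u
      exact exists_eq_two_nsmul_of_sub_theta_eq_sq ha₁ ha₃ ha₂ ha₄ ha₆ hq hlinK h hu
  -- the torsion point `T = (0, 0)`: finite order, `μ_θ(T) = (−θ)·K×² ≠ 1`
  have hTE : W.toAffine.Equation 0 0 := by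
    rw [equation_iff, ha₆]
    ring
  have hT : W.toAffine.Nonsingular 0 0 := equation_iff_nonsingular.mp hTE
  have hTfin : IsOfFinAddOrder (some 0 0 hT : W.toAffine.Point) := by
    refine (isOfFinAddOrder_iff_nsmul_eq_zero).mpr ⟨2, two_pos, ?_⟩
    rw [two_nsmul, add_self_of_Y_eq]
    rw [negY, ha₁, ha₃]
    ring
  have h₁ : ψ (some 0 0 hT) ≠ 0 := by
    intro h0
    rw [hψ, muHom_apply, ofMul_eq_zero, muMap_some] at h0
    obtain ⟨u, hu⟩ := (sqClass_eq_one_iff (sub_ne_zero.mpr (hne 0))).mp h0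
    obtain ⟨c₀, c₁, rfl⟩ := hspanK u
    rw [_root_.map_zero] at hu
    exact hb (isSquare_of_neg_theta_eq_sq hq hlinK hu)
  -- image inside `S`
  have hS' : ∀ P : W.toAffine.Point, ψ P ∈ S.map (Equiv.toEmbedding Additive.ofMul) := by
    intro P
    rw [Finset.mem_map_equiv]
    rcases P with _ | @⟨x, y, h⟩
    · show Additive.toMul (Additive.ofMul (muMap W.toAffine φ θ 0)) ∈ S
      rw [muMap_zero]
      exact h1
    · simpa only [hψ, muHom_apply, muMap_some, Additive.ofMul_symm_eq, toMul_ofMul] using hS x y h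
  have hcard' : (S.map (Equiv.toEmbedding Additive.ofMul)).card < 2 ^ (s + 2) := by
    rw [Finset.card_map]
    exact hcard
  rw [WeierstrassCurve.mordellWeilRank]
  exact finrank_le_of_range_subset ψ hker hTfin h₁ _ hS' hcard'

end RankBound

/-! ## From certificates: the `V`-cover of the tree (`…2DescVCover`, no irreducibility needed) -/

section CoverSet

open scoped NumberField

open IsDedekindDomain NumberField

variable {K : Type*} [Field K] [NumberField K] {m s : ℕ}

/-- **Rank bound of the quadratic-field 2-descent from certificates.** `E = E_{A,B} : y² = x³ + Ax² + Bx`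
over `ℚ` (`A, B ∈ ℤ`, `B` not a rational square), `θ ∈ 𝓞 K` with `θ² + Aθ + B = 0` and `1, θ` a
`ℚ`-basis of `K` (so `K = ℚ(θ)` is the quadratic field of the irreducible factor), `𝓞 K` a PID;
`G` an injective family of non-zero integers containing up to association every prime divisor of
`F′(θ) = 3θ² + 2Aθ + B`; `Wu` units spanning `(𝓞 K)ˣ/(𝓞 K)ˣ²`; `adm` a Boolean sieve accepting every
pair realised by a rational point, with the empty pair admissible. Then `rank E(ℚ) ≤ s'` whenever
the number of admissible pairs is `≤ 2^{s'+1}` (the extra factor `2` is the class `μ_θ(T) ≠ 1` of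
the rational `2`-torsion point). The cover half is the tree's `sqClass_mem_coverSet` verbatim with
`C = 0` — it never used irreducibility of the cubic. [cite: Cassels1991LecturesEllipticCurves, §15] -/
theorem mordellWeilRank_le_of_coverSet_z2 [IsPrincipalIdealRing (𝓞 K)] {A B : ℤ}
    (E : WeierstrassCurve ℚ) [E.IsElliptic] (ha₁ : E.a₁ = 0) (ha₂ : E.a₂ = A) (ha₃ : E.a₃ = 0)
    (ha₄ : E.a₄ = B) (ha₆ : E.a₆ = 0) {θ : 𝓞 K} (hθ : θ ^ 2 + A * θ + B = 0)
    (hlinK : ∀ c₀ c₁ : ℚ, algebraMap ℚ K c₁ * algebraMap (𝓞 K) K θ + algebraMap ℚ K c₀ = 0 →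
      c₀ = 0 ∧ c₁ = 0)
    (hspanK : ∀ z : K, ∃ c₀ c₁ : ℚ,
      z = algebraMap ℚ K c₁ * algebraMap (𝓞 K) K θ + algebraMap ℚ K c₀)
    (hB : ¬ IsSquare (B : ℚ))
    {G : Fin s → 𝓞 K} (hG : Function.Injective G) (hG0 : ∀ j, G j ≠ 0)
    (hD : ∀ q : 𝓞 K, Prime q → q ∣ 3 * θ ^ 2 + 2 * A * θ + B → ∃ j, Associated q (G j))
    {Wu : Fin m → (𝓞 K)ˣ}
    (hW : ∀ u : (𝓞 K)ˣ, ∃ T : Finset (Fin m), IsSquare (u * ∏ i ∈ T, Wu i))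
    {adm : Finset (Fin m) → Finset (Fin s) → Bool} (h0 : adm ∅ ∅ = true)
    (hadm : ∀ x y : ℚ, y ^ 2 = x ^ 3 + A * x ^ 2 + B * x →
      ∀ (T : Finset (Fin m)) (U : Finset (Fin s)),
        IsSquare ((algebraMap ℚ K x - algebraMap (𝓞 K) K θ) *
          (∏ i ∈ T, algebraMap (𝓞 K) K (Wu i)) * ∏ j ∈ U, algebraMap (𝓞 K) K (G j)) →
        adm T U = true)
    {s' : ℕ} (hcard : ((Finset.univ ×ˢ Finset.univ).filter
      (fun p : Finset (Fin m) × Finset (Fin s) => adm p.1 p.2 = true)).card < 2 ^ (s' + 2)) :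
    E.mordellWeilRank ≤ s' := by
  -- the cubic relation `θ³ + Aθ² + Bθ + 0 = 0` in `𝓞 K` and the quadratic one in `K`
  have hF : θ ^ 3 + A * θ ^ 2 + B * θ + ((0 : ℤ) : 𝓞 K) = 0 := by
    rw [Int.cast_zero, add_zero]
    linear_combination θ * hθ
  have hθK : (algebraMap (𝓞 K) K θ) ^ 2 + algebraMap ℚ K (A : ℚ) * algebraMap (𝓞 K) K θ +
      algebraMap ℚ K (B : ℚ) = 0 := by
    have h := congrArg (algebraMap (𝓞 K) K) hθ
    simp only [map_add, map_mul, map_pow, map_intCast, _root_.map_zero] at h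
    simpa only [map_intCast] using h
  have hθQ : ∀ q : ℚ, algebraMap ℚ K q ≠ algebraMap (𝓞 K) K θ := ne_of_linIndep₂ hlinK
  have hadm' : ∀ x y : ℚ, y ^ 2 = x ^ 3 + A * x ^ 2 + B * x + ((0 : ℤ) : ℚ) →
      ∀ (T : Finset (Fin m)) (U : Finset (Fin s)),
        IsSquare ((algebraMap ℚ K x - algebraMap (𝓞 K) K θ) *
          (∏ i ∈ T, algebraMap (𝓞 K) K (Wu i)) * ∏ j ∈ U, algebraMap (𝓞 K) K (G j)) →
        adm T U = true := by
    intro x y h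
    rw [Int.cast_zero, add_zero] at h
    exact hadm x y h
  refine mordellWeilRank_le_of_sqClass_cover_z2 E (algebraMap ℚ K) ha₁ ha₃ ha₂ ha₄ ha₆ hθK hlinK
    hspanK hB (coverSet Wu G adm) (one_mem_coverSet Wu G h0) ?_
    ((card_coverSet_le Wu G adm).trans_lt hcard)
  intro x y hxy
  have hE : y ^ 2 = x ^ 3 + A * x ^ 2 + B * x + ((0 : ℤ) : ℚ) := by
    have h := hxy.left
    rw [WeierstrassCurve.Affine.equation_iff] at h
    have e₁ : E.toAffine.a₁ = 0 := ha₁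
    have e₂ : E.toAffine.a₂ = A := ha₂
    have e₃ : E.toAffine.a₃ = 0 := ha₃
    have e₄ : E.toAffine.a₄ = B := ha₄
    have e₆ : E.toAffine.a₆ = 0 := ha₆
    rw [e₁, e₂, e₃, e₄, e₆] at h
    rw [Int.cast_zero, add_zero]
    linear_combination h
  exact sqClass_mem_coverSet hF hθQ hG hG0 hD hW hadm' hE

end CoverSet

end Summit.BirchSwinnertonDyer.BirchSwinnertonDyer.Rank2Observatory.TwoDescZ2

end
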